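import Summits.CriticalPhenomena.PercolationContinuityZ3.Theorems.Transplant.PlanarSkeletonFrmFromDefs
import Summits.CriticalPhenomena.PercolationContinuityZ3.Theorems.Transplant.SkelFrmFrom1ClosureLTK
import Summits.CriticalPhenomena.PercolationContinuityZ3.Theorems.Transplant.SkelFrm1ClosureLTK
import Summits.CriticalPhenomena.PercolationContinuityZ3.Theorems.Transplant.SkelFrmFrom1ChoiceLT
import Summits.CriticalPhenomena.PercolationContinuityZ3.Theorems.Transplant.SkelFrm1ChoiceLT
import Summits.CriticalPhenomena.PercolationContinuityZ3.Theorems.Transplant.SkelNeg1ParamsP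
import HarnessLib
import Summits.CriticalPhenomena.PercolationContinuityZ3.Theorems.Transplant.SkelFrm1ChoiceLTK
/-!
# U-WAVE PORT (RULING D-U, lead g21 2026-08-26; WAVE-U-MANIFEST v3.0 row «SkelFrm1ChoiceLTK» ↦ «SkelFrmFrom1ChoiceLTK») of the tree module
# `Transplant/SkelFrm1ChoiceLTK` onto the carrier `PlanarSkeletonFrmFrom` (frames only, cylinders connected from width `ℓ₀` on)

ORIGINAL TITLE: N2 (the frames-only node `SamePDropOfSkeletonFrm₁`, OPEN), (c2) J20/J21 REPAIR ((R-42), lead g12 2026-08-23T09:18:18Z/09:49:01Z; design owner p3): THE CHOICE-LEVEL CLOSURE OF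

builds on p205010 (kernel theorem, internal audit signed; external expert review pending) — nothing in this file uses p205010; NOTHING is claimed about the
OPEN node U `SamePDropOfSkeletonFrmFrom₁` (nor U_s / the end state).  Lane `prim-bschramm`, seat `prim-bschramm-p3` gen 26; helper file
(`--supports stmt-CriticalPhenomena-4575 --as helper`).  PORT RULES r1–r4 of RULING D-U: declaration order and proof texts are those of the original,
byte-identical except (i) the carrier token `PlanarSkeletonFrm ↦ PlanarSkeletonFrmFrom` (binders, `namespace`/`end` lines, qualified names of twinned
declarations), (ii) carrier-FREE declarations of the original (φ-level `Skelφ…` blocks and namespace-only arithmetic residents) are NOT re-declared —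
this file imports the original and `export`s the twin-free residents (POLICY T / treatment (m1)); residents whose statement mentions a twinned
constant are copied, (iii) every carrier-binding declaration keeps its explicit binder `(Φ : PlanarSkeletonFrmFrom G)` in its own signature (r2).  Docstrings and citations are the original's.
-/

noncomputable section

open MeasureTheory ProbabilityTheory
open scoped ENNReal Classical

namespace Summit.CriticalPhenomena.PercolationContinuityZ3.Theorems.Transplant

open Literature.Probability.Percolation Literature.Probability.LatticeModels SimpleGraph KNCells KNLevels
open Literature.Barriers.CriticalPhenomena (HasExponentialGrowth)
open SkelConc (Consts)

namespace PlanarSkeletonNeg.Neg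

end PlanarSkeletonNeg.Neg

namespace PlanarSkeletonFrmFrom

/-- **The (R) column Prop under the K-floor**: the forward law-carrying root obligation of an N2 choice function GIVEN the flat root table, asked only for
`Kmin ≤ κ.K₀` (`RootHoldsNQWFnL`'s body verbatim behind the floor). [this work] -/
def RootHoldsNQWFnLK (Lf : ℕ → ℕ) (Kmin : ℕ) (𝒞₀ : ChoiceFnNQ) : Prop :=
  ∀ (κ : Consts) {V : Type} [DecidableEq V] [Countable V] (G : SimpleGraph V) [G.LocallyFinite] (Φ : PlanarSkeletonFrmFrom G)
    (hg : ¬ HasExponentialGrowth G) (t : V) (ht : t ∈ Φ.types) (h1 : Φ.types = {t}) (p : unitInterval) (hp0 : 0 < (p : ℝ)) (hp1 : (p : ℝ) < 1)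
    (hC : Φ.CylSubcritical p), Kmin ≤ κ.K₀ → FlatQ Lf κ → (𝒞₀ κ G Φ hg t ht h1 p hp0 hp1 hC).RootHoldsNQW

/-- **The (F) column Prop under the K-floor**: the face obligation GIVEN flatness and the face inner-chain fact at target accuracy `dT κ.δ₂`, asked only for
`Kmin ≤ κ.K₀` (`FaceHoldsRNQFnLT`'s body verbatim behind the floor; the (F) wrapper takes `dT := fun x => x ^ 3`). [this work] -/
def FaceHoldsRNQFnLTK (Lf : ℕ → ℕ) (dT : ℝ → ℝ) (Kmin : ℕ) (𝒞₀ : ChoiceFnNQ) : Prop :=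
  ∀ (κ : Consts) {V : Type} [DecidableEq V] [Countable V] (G : SimpleGraph V) [G.LocallyFinite] (Φ : PlanarSkeletonFrmFrom G)
    (hg : ¬ HasExponentialGrowth G) (t : V) (ht : t ∈ Φ.types) (h1 : Φ.types = {t}) (p : unitInterval) (hp0 : 0 < (p : ℝ)) (hp1 : (p : ℝ) < 1)
    (hC : Φ.CylSubcritical p), Kmin ≤ κ.K₀ → FlatQ Lf κ → ChainFactQT Lf G Φ.Δ κ (dT κ.δ₂) → (𝒞₀ κ G Φ hg t ht h1 p hp0 hp1 hC).FaceHoldsRNQ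

/-- **The (C) column Prop under the K-floor**: the length-budgeted corridor obligation of an N2 choice function, asked only for `Kmin ≤ κ.K₀`
(`ReachHoldsRHNQFnL`'s body verbatim behind the floor). [this work] -/
def ReachHoldsRHNQFnLK (Lf : ℕ → ℕ) (Kmin : ℕ) (𝒞₀ : ChoiceFnNQ) : Prop :=
  ∀ (κ : Consts) {V : Type} [DecidableEq V] [Countable V] (G : SimpleGraph V) [G.LocallyFinite] (Φ : PlanarSkeletonFrmFrom G)
    (hg : ¬ HasExponentialGrowth G) (t : V) (ht : t ∈ Φ.types) (h1 : Φ.types = {t}) (p : unitInterval) (hp0 : 0 < (p : ℝ)) (hp1 : (p : ℝ) < 1)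
    (hC : Φ.CylSubcritical p), Kmin ≤ κ.K₀ → (𝒞₀ κ G Φ hg t ht h1 p hp0 hp1 hC).ReachHoldsRHNQL Lf

/-- The floor-free Props imply their K-versions for every `Kmin` (so a floor-free wrapper, where one exists, serves the K-closure as is). [folklore] -/
theorem holdsK_of_holds (Lf : ℕ → ℕ) (dT : ℝ → ℝ) (Kmin : ℕ) (𝒞₀ : ChoiceFnNQ) :
    (RootHoldsNQWFnL Lf 𝒞₀ → RootHoldsNQWFnLK Lf Kmin 𝒞₀) ∧ (FaceHoldsRNQFnLT Lf dT 𝒞₀ → FaceHoldsRNQFnLTK Lf dT Kmin 𝒞₀) ∧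
      (ReachHoldsRHNQFnL Lf 𝒞₀ → ReachHoldsRHNQFnLK Lf Kmin 𝒞₀) :=
  ⟨fun h κ _ _ _ G _ Φ hg t ht h1 p hp0 hp1 hC _ => h κ G Φ hg t ht h1 p hp0 hp1 hC,
    fun h κ _ _ _ G _ Φ hg t ht h1 p hp0 hp1 hC _ => h κ G Φ hg t ht h1 p hp0 hp1 hC,
    fun h κ _ _ _ G _ Φ hg t ht h1 p hp0 hp1 hC _ => h κ G Φ hg t ht h1 p hp0 hp1 hC⟩

/-- **THE N2 PARTIAL CLOSURE OF RECORD, shared-choice form, face target accuracy `dT`, K-floor `Kmin`** (J20/J21, (R-42); twin of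
`samePDropOfSkeletonFrm₁_of_choiceFnNQLT` over `samePDropOfSkeletonFrm₁_of_residuesNQLTK`): an N2 choice function meeting the geometric obligation and — for every `κ`
with `Kmin ≤ κ.K₀` — the forward law-carrying root obligation given flatness, the face obligation given flatness and the inner-chain fact at `dT κ.δ₂` (`0 < dT x` for
`0 < x`), and the budgeted corridor obligation gives `SamePDropOfSkeletonFrm₁`. [cite: KozmaNitzan2024, §4 Theorem 6 (pp. 25–31); §1 p. 2] -/
theorem samePDropOfSkeletonFrmFrom₁_of_choiceFnNQLTK (Lf : ℕ → ℕ) (dT : ℝ → ℝ) (hdT : ∀ x : ℝ, 0 < x → 0 < dT x) (Kmin : ℕ)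
    (𝒞₀ : ChoiceFnNQ) (hGm : GeomHoldsNQFn 𝒞₀) (hR : RootHoldsNQWFnLK Lf Kmin 𝒞₀)
    (hF : FaceHoldsRNQFnLTK Lf dT Kmin 𝒞₀) (hRe : ReachHoldsRHNQFnLK Lf Kmin 𝒞₀) : SamePDropOfSkeletonFrmFrom₁ := by
  refine samePDropOfSkeletonFrmFrom₁_of_residuesNQLTK Lf dT hdT Kmin
    fun K₀ δ δ₂ δr hKmin hδ0 hδ1 hδ₂0 hδ₂1 hδr hflat {V} _ _ G _ Φ hg t ht h1 p hp0 hp1 _ hC _ hCF => ?_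
  set κ : Consts := ⟨K₀, δ, δ₂, δr, hδ0, hδ1, hδ₂0, hδ₂1, hδr⟩ with hκ
  have hKmin' : Kmin ≤ κ.K₀ := hKmin
  have hflat' : FlatQ Lf κ := hflat
  have hCF' : ChainFactQT Lf G Φ.Δ κ (dT κ.δ₂) := hCF
  set 𝒞 := 𝒞₀ κ G Φ hg t ht h1 p hp0 hp1 hC with h𝒞
  refine ⟨𝒞.δI, 𝒞.m₀, 𝒞.δI_pos, 𝒞.δI_lt_one, fun O hfacts => ?_⟩
  obtain ⟨hSz, hSMn⟩ := 𝒞.S_adm O hfacts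
  refine ⟨𝒞.Sz O, 𝒞.SMn O, hSz, hSMn, fun q hq1 hq2 hin hCq => ?_⟩
  have hat : 𝒞.AtQNQ O q := ⟨hfacts, hq1, hq2, hin, hCq⟩
  obtain ⟨hroot, hK, hrun, hanch, hsep, hexit, hsteps, hlev⟩ := hGm κ G Φ hg t ht h1 p hp0 hp1 hC O q hat
  obtain ⟨nmax, hnmax, hreach⟩ := hRe κ G Φ hg t ht h1 p hp0 hp1 hC hKmin' O q hat
  exact ⟨𝒞.Γ O q, 𝒞.FD O q, 𝒞.LD O q, hroot, hK, hrun, hanch, hsep, hexit, hsteps, hlev,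
    hR κ G Φ hg t ht h1 p hp0 hp1 hC hKmin' hflat' O q hat, hF κ G Φ hg t ht h1 p hp0 hp1 hC hKmin' hflat' hCF' O q hat, nmax, hnmax, hreach⟩

end PlanarSkeletonFrmFrom

end Summit.CriticalPhenomena.PercolationContinuityZ3.Theorems.Transplant

end
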